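import Literature.Computability.AlgebraicComplexity.FlipGraphStdStrassenDistance
import Literature.Computability.AlgebraicComplexity.FlipGraphSymmetryNormalForm
import HarnessLib

/-!
# Vertices of the standard algorithm's component that no forward search reaches (`(2,2,2)`, `ℤ₂`; KM 2023 §4)

Topic `Literature/Computability/AlgebraicComplexity`. Source: M. Kauers, J. Moosbauer, *Flip Graphs
for Matrix Multiplication*, ISSAC 2023 = arXiv:2212.01175 (KM). KM §4, on `K = ℤ₂`: "The
`(2,2,2)`-flip graph of rank at most `8` for `K = ℤ₂` is not too big. Fig. 1 shows the connected
component to which the standard algorithm belongs. It has `272` vertices, each representing the orbit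
of one multiplication scheme, and `1183` edges, `7` of which are reductions … The component also
contains Strassen's algorithm." Components are meant in the WEAK sense (Def. 8 defines the directed
graph `(V, E₁ ∪ E₂)` of flips and reductions; Thm. 9: "the `(n,m,p)`-flip graph is weakly connected,
i.e., the undirected graph obtained from it by replacing every reduction by a bidirectional edge, is
connected").

## What is typed (everything PROVED, a kernel-replayed certificate; no named facts)

Over the tree's vocabulary (`FlipGraphConnectivity.lean`: KM Def. 1 `Scheme`, Def. 4 `Flips`,
Prop. 3 `Reduces`; `FlipGraphEquivariance.lean`: KM's group `G` = `InSymmetryGroup`, the orbit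
relation `orbitSetoidKM`, the directed flip graph on orbits `flipGraphKM`;
`FlipGraphStdStrassenDistance.lean`: the undirected simple graph `flipGraph222LE8` underlying KM's
`(2,2,2)`-flip graph of rank at most `8` over `ℤ₂`, its vertices `vtxStd`, `vtxStrassen`):

* §1–§2 (infrastructure) **an orbit test**: by the normal form of `G`
  (`FlipGraphSymmetryNormalForm.lean`: every `g ∈ G` is a sandwich followed by one of six words)
  every element of `G` acts on the `4`-bit codes of `FlipGraph222BallCert.lean` by one of the
  `6⁴ = 1296` code maps `actNF` (`InSymmetryGroup.exists_word`); hence two schemes presented by code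
  lists that NO word matches up to order lie in different orbits (`not_equiv_of_noMatch`).
* §3–§6 **seven explicit rank-`8` schemes** `hs i` of `⟨2,2,2⟩` over `ℤ₂` (`hidden`), pairwise
  inequivalent and inequivalent to the standard algorithm, such that
  (a) each of their orbits lies in the connected component of the standard algorithm in
      `flipGraph222LE8` (`reachable_vtxStd_hv`): `hs 0, …, hs 4` are splits of a scheme of Strassen's
      orbit, i.e. they REDUCE to Strassen's orbit (`reduces_hs_V8`), and `hs 5`, `hs 6` are flips of
      `hs 4` (`flips_H4_H5`, `flips_H4_H6`);
  (b) NONE of them is reachable from the orbit of the standard algorithm by a DIRECTED path of KM's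
      flip graph — by flips and reductions starting from the standard algorithm
      (`not_fwdReachable_hv`): `hs 0, …, hs 3` admit no flip at all (`not_flips_hs`), the three orbits
      of `hs 4, hs 5, hs 6` are closed under flips (a `12 + 8 + 8`-entry flip→orbit certificate,
      `hidden_ok`), no reduction enters a rank-`8` orbit from rank `≤ 8`, and ranks never increase
      along directed paths;
  (c) summary: `kauersMoosbauer2023_fig1_component_has_seven_unreachable_vertices`.

So the component of the standard algorithm in KM's Fig. 1 graph contains (at least) seven vertices
that a search exploring flips and reductions FROM the standard algorithm never visits; they are
attached to the component only through reduction arrows INTO Strassen's orbit (and flips among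
themselves). This is the mechanism behind the one-vertex difference between KM's printed count
`272` (= the authors' published vertex data, `github.com/jakobmoosbauer/flips`,
`222flipgraph_rank8/`, which contain six of these seven orbits) and this cell's exhaustive weak
component of `273` orbits (`272` of rank `8` + Strassen's); the orbit of `hs 3` is the one absent
from the published data (cell cross-check `lit/LIT1-222-CROSSCHECK.md`). The COUNT `273` itself is
NOT a kernel statement here (it needs the exhaustive enumeration); this file proves membership,
unreachability and distinctness of the seven.

HONEST FRAMING: a statement about `⟨2,2,2⟩` over `ℤ₂` and KM's flip graph of rank at most `8`;
KM do not print how the component was computed, and nothing here says their procedure was a pure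
forward search — only that a forward search cannot produce the whole weak component. No claim about
other fields, formats, or KM's other printed numbers.

## References

* M. Kauers, J. Moosbauer, *Flip Graphs for Matrix Multiplication*, ISSAC 2023, 381–388,
  doi:10.1145/3597066.3597120, arXiv:2212.01175: Def. 1, Def. 2, Prop. 3, Def. 4, Def. 8, Thm. 9,
  §2 (symmetry group), §3 (splits: "The result is a scheme that admits a reduction to `S`"), §4 and
  Fig. 1 (`272` vertices, `1183` edges, `7` reductions). [KauersMoosbauer2022FlipGraphs]
* M. J. H. Heule, M. Kauers, M. Seidl, *New ways to multiply 3 × 3-matrices*, J. Symbolic Comput.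
  104 (2021) 899–916: §4–§5 (the group `GL(K,n)³ × S₃`). [HeuleKauersSeidl2021]
* V. Strassen, *Gaussian elimination is not optimal*, Numer. Math. 13 (1969) 354–356. [Strassen1969]
-/

set_option Elab.async false

namespace Literature.Computability.AlgebraicComplexity

open scoped BigOperators Kronecker
open Multiset Matrix

namespace FlipGraph

namespace Hidden222

open Cert222 StdBall222

/-! ## §1 Every element of `G` acts on code triples by one of `1296` words -/

/-- The code action in NORMAL-FORM order: the sandwich `(P,Q,R) = (glMat i_P, glMat i_Q, glMat i_R)`
first, then the word `σ_k` (`FlipGraphSymmetryNormalForm.lean`: `g = (sandwich P Q R) ∘ σ_k`).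
[cite: HeuleKauersSeidl2021, §4 (`G = GL(K,n)³ × S₃`)] -/
def actNF (g : ℕ × ℕ × ℕ × ℕ) (t : Tri) : Tri := s3Tri g.1 (sandTri g.2.1 g.2.2.1 g.2.2.2 t)

/-- Over `ℤ₂`, every invertible `2 × 2` matrix is one of the six `glMat i`. [folklore] -/
private theorem exists_glMat_eq (P : Matrix (Fin 2) (Fin 2) (ZMod 2)) (hP : IsUnit P.det) :
    ∃ i, i < 6 ∧ glMat i = P := by
  have hdet : P 0 0 * P 1 1 - P 0 1 * P 1 0 ≠ 0 := by
    rw [← Matrix.det_fin_two]; exact hP.ne_zero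
  have key : ∀ M : Matrix (Fin 2) (Fin 2) (ZMod 2), M 0 0 * M 1 1 - M 0 1 * M 1 0 ≠ 0 →
      ∃ i : Fin 6, glMat i.val = M := by decide
  obtain ⟨i, hi⟩ := key P hdet
  exact ⟨i.val, i.isLt, hi⟩

/-- The six words of the normal-form file are the six words of the certificate file.
[cite: KauersMoosbauer2022FlipGraphs, §2 (symmetry group)] -/
theorem permSym_eq_s3Sym (k : ℕ) : permSym (ZMod 2) 2 k = s3Sym k := by
  rcases k with _ | _ | _ | _ | _ | _ | _ <;> rfl

/-- Unpacking `wfC`. [folklore] -/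
private theorem wfC_iff' {v : ℕ} : wfC v = true ↔ 0 < v ∧ v < 16 := by
  simp [wfC]

/-- Unpacking `wfT`. [folklore] -/
private theorem wfT_iff' {p : Tri} :
    wfT p = true ↔ (0 < p.1 ∧ p.1 < 16) ∧ (0 < p.2.1 ∧ p.2.1 < 16) ∧ (0 < p.2.2 ∧ p.2.2 < 16) := by
  simp [wfT, wfC_iff', Bool.and_eq_true, and_assoc]

/-- Unpacking `wfL`. [folklore] -/
private theorem wfL_iff' {L : List Tri} : wfL L = true ↔ ∀ p ∈ L, wfT p = true := by
  simp [wfL, List.all_eq_true]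

/-- The table action keeps non-zero codes non-zero and `< 16` (kernel evaluation). [folklore] -/
private theorem pxq_wf : ∀ (i j : Fin 6) (v : Fin 16), 0 < v.val → 0 < pxq i j v ∧ pxq i j v < 16 := by
  decide

/-- Transposition keeps non-zero codes non-zero and `< 16` (kernel evaluation). [folklore] -/
private theorem tc_wf : ∀ v : Fin 16, 0 < v.val → 0 < tc v ∧ tc v < 16 := by decide

/-- The index bookkeeping of the sandwich stays in range (kernel evaluation). [folklore] -/
private theorem glTr_glInv_lt : ∀ i : Fin 6, glTr (glInv i) < 6 := by decide

/-- `pxq` on well-formed codes. [folklore] -/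
private theorem wfC_pxq {i j v : ℕ} (hi : i < 6) (hj : j < 6) (hv : wfC v = true) :
    wfC (pxq i j v) = true := by
  obtain ⟨h0, h16⟩ := wfC_iff'.mp hv
  exact wfC_iff'.mpr (pxq_wf ⟨i, hi⟩ ⟨j, hj⟩ ⟨v, h16⟩ h0)

/-- `tc` on well-formed codes. [folklore] -/
private theorem wfC_tc {v : ℕ} (hv : wfC v = true) : wfC (tc v) = true := by
  obtain ⟨h0, h16⟩ := wfC_iff'.mp hv
  exact wfC_iff'.mpr (tc_wf ⟨v, h16⟩ h0)

/-- The sandwich on codes keeps well-formedness. [folklore] -/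
private theorem wfT_sandTri {ip iq ir : ℕ} (hp : ip < 6) (hq : iq < 6) (hr : ir < 6) {t : Tri}
    (ht : wfT t = true) : wfT (sandTri ip iq ir t) = true := by
  simp only [wfT, Bool.and_eq_true] at ht ⊢
  obtain ⟨⟨h1, h2⟩, h3⟩ := ht
  refine ⟨⟨wfC_pxq (glTr_glInv_lt ⟨ip, hp⟩) (glTr_glInv_lt ⟨ir, hr⟩) h1, wfC_pxq hp hq h2⟩,
    wfC_pxq (glTr_glInv_lt ⟨iq, hq⟩) hr h3⟩

/-- `trT` keeps well-formedness. [folklore] -/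
private theorem wfT_trT {t : Tri} (ht : wfT t = true) : wfT (trT t) = true := by
  simp only [wfT, Bool.and_eq_true] at ht ⊢
  exact ⟨⟨wfC_tc ht.1.1, wfC_tc ht.2⟩, wfC_tc ht.1.2⟩

/-- `cyT` keeps well-formedness. [folklore] -/
private theorem wfT_cyT {t : Tri} (ht : wfT t = true) : wfT (cyT t) = true := by
  simp only [wfT, Bool.and_eq_true] at ht ⊢
  exact ⟨⟨wfC_tc ht.1.2, ht.2⟩, wfC_tc ht.1.1⟩

/-- The words keep well-formedness. [folklore] -/
private theorem wfT_s3Tri (k : ℕ) {t : Tri} (ht : wfT t = true) : wfT (s3Tri k t) = true := by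
  rcases k with _ | _ | _ | _ | _ | _ | _
  · exact ht
  · exact wfT_trT ht
  · exact wfT_cyT ht
  · exact wfT_trT (wfT_cyT ht)
  · exact wfT_cyT (wfT_cyT ht)
  · exact wfT_trT (wfT_cyT (wfT_cyT ht))
  · exact ht

/-- `actNF g` keeps well-formedness (for a word in range). [folklore] -/
private theorem wfT_actNF {g : ℕ × ℕ × ℕ × ℕ} (hg : wfG g = true) {t : Tri} (ht : wfT t = true) :
    wfT (actNF g t) = true := by
  simp only [wfG, Bool.and_eq_true, decide_eq_true_eq] at hg
  obtain ⟨⟨⟨_, hp⟩, hq⟩, hr⟩ := hg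
  exact wfT_s3Tri g.1 (wfT_sandTri hp hq hr ht)

/-- Bounds of a well-formed triple, in the shape the certificate file's lemmas expect. [folklore] -/
private theorem bd_of_wfT {t : Tri} (ht : wfT t = true) : t.1 < 16 ∧ t.2.1 < 16 ∧ t.2.2 < 16 := by
  obtain ⟨⟨_, h1⟩, ⟨_, h2⟩, ⟨_, h3⟩⟩ := wfT_iff'.mp ht
  exact ⟨h1, h2, h3⟩

/-- **Every element of KM's group acts on code triples by a word** (normal form
`g = (sandwich P Q R) ∘ σ_k` of `FlipGraphSymmetryNormalForm.lean`, with `P, Q, R ∈ GL₂(ℤ₂)` among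
the six `glMat i`): `g(tr3 t) = tr3 (actNF (k, i_P, i_Q, i_R) t)` for every well-formed `t`.
[cite: HeuleKauersSeidl2021, §4–§5 (`G = GL(K,n)³ × S₃`); KM §2] -/
theorem InSymmetryGroup.exists_word {φ : Symmetry (matMulTensor (ZMod 2) 2 2 2)}
    (hφ : InSymmetryGroup φ) :
    ∃ g : ℕ × ℕ × ℕ × ℕ, wfG g = true ∧
      ∀ t : Tri, wfT t = true → φ.toLinearEquiv (tr3 t) = tr3 (actNF g t) := by
  obtain ⟨k, hk, P, Q, R, hP, hQ, hR, h⟩ := hφ.exists_normalForm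
  obtain ⟨ip, hip, rfl⟩ := exists_glMat_eq P hP
  obtain ⟨iq, hiq, rfl⟩ := exists_glMat_eq Q hQ
  obtain ⟨ir, hir, rfl⟩ := exists_glMat_eq R hR
  refine ⟨(k, ip, iq, ir), by simp [wfG, hk, hip, hiq, hir], fun t ht => ?_⟩
  obtain ⟨b1, b2, b3⟩ := bd_of_wfT ht
  rw [h]
  -- the sandwich on a presented rank-one tensor
  have hs := sandwich_tr3 ip iq ir hip hiq hir t ⟨b1, b2, b3⟩
  rw [sandwich_apply, swAct] at hs
  rw [hs]
  -- the word on a presented rank-one tensor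
  obtain ⟨c1, c2, c3⟩ := bd_of_wfT (wfT_sandTri hip hiq hir ht)
  show permMap 2 k (tr3 (sandTri ip iq ir t)) = tr3 (s3Tri k (sandTri ip iq ir t))
  rw [← permSym_apply (K := ZMod 2), permSym_eq_s3Sym]
  exact s3Sym_tr3 k _ ⟨c1, c2, c3⟩

/-! ## §2 An orbit test: no word matches -/

/-- The `1296` words `(k, i_P, i_Q, i_R)`, all four indices `< 6`. [folklore] -/
def words : List (ℕ × ℕ × ℕ × ℕ) :=
  (List.range 6).flatMap fun k => (List.range 6).flatMap fun a =>
    (List.range 6).flatMap fun b => (List.range 6).map fun c => (k, a, b, c)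

/-- A word in range is listed. [folklore] -/
private theorem mem_words {g : ℕ × ℕ × ℕ × ℕ} (hg : wfG g = true) : g ∈ words := by
  obtain ⟨k, a, b, c⟩ := g
  simp only [wfG, Bool.and_eq_true, decide_eq_true_eq] at hg
  simp only [words, List.mem_flatMap, List.mem_map, List.mem_range]
  exact ⟨k, hg.1.1.1, a, hg.1.1.2, b, hg.1.2, c, hg.2, rfl⟩

/-- **The orbit test:** no word maps the code list `L` onto `L'` as a multiset.
[cite: KauersMoosbauer2022FlipGraphs, §2 (equivalence = same orbit)] -/
def noMatch (L L' : List Tri) : Bool :=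
  words.all fun g => !decide ((L.map (actNF g) : Multiset Tri) = (L' : Multiset Tri))

/-- Decoding is injective on codes `< 16` (kernel evaluation). [folklore] -/
private theorem dec_inj16 : ∀ v w : Fin 16, dec v.val = dec w.val → v = w := by decide

/-- **Over `ℤ₂` a well-formed code triple is determined by the tensor it presents** (a non-zero
rank-one tensor determines its factors, `triad_factors_eq_of_two`). [folklore] -/
private theorem tr3_injOn {t t' : Tri} (ht : wfT t = true) (ht' : wfT t' = true) (h : tr3 t = tr3 t') :
    t = t' := by
  obtain ⟨⟨_, h1⟩, ⟨_, h2⟩, ⟨_, h3⟩⟩ := wfT_iff'.mp ht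
  obtain ⟨⟨_, k1⟩, ⟨_, k2⟩, ⟨_, k3⟩⟩ := wfT_iff'.mp ht'
  have h' : triad (dec t.1) (dec t.2.1) (dec t.2.2) = (triad (dec t'.1) (dec t'.2.1) (dec t'.2.2) : T) := h
  obtain ⟨e1, e2, e3⟩ := triad_factors_eq_of_two (K := ZMod 2) (by decide) h' (tr3_ne_zero ht)
  have f1 := congrArg Fin.val (dec_inj16 ⟨t.1, h1⟩ ⟨t'.1, k1⟩ e1)
  have f2 := congrArg Fin.val (dec_inj16 ⟨t.2.1, h2⟩ ⟨t'.2.1, k2⟩ e2)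
  have f3 := congrArg Fin.val (dec_inj16 ⟨t.2.2, h3⟩ ⟨t'.2.2, k3⟩ e3)
  simp only at f1 f2 f3
  exact Prod.ext f1 (Prod.ext f2 f3)

/-- `elts3` is the multiset map of `tr3` (bookkeeping). [folklore] -/
private theorem elts3_eq_map (L : List Tri) : elts3 L = Multiset.map tr3 (L : Multiset Tri) := by
  simp [elts3]

/-- **Well-formed code lists presenting the same multiset of tensors are equal as multisets.**
[folklore] -/
private theorem coe_eq_of_elts3_eq {L₁ L₂ : List Tri} (h₁ : wfL L₁ = true) (h₂ : wfL L₂ = true)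
    (h : elts3 L₁ = elts3 L₂) : (L₁ : Multiset Tri) = (L₂ : Multiset Tri) := by
  classical
  rw [wfL_iff'] at h₁ h₂
  rw [elts3_eq_map, elts3_eq_map] at h
  have hinj : ∀ L : List Tri, (∀ p ∈ L, wfT p = true) →
      Set.InjOn tr3 {x | x ∈ (L : Multiset Tri)} := fun L hL x hx y hy hxy =>
    tr3_injOn (hL x (by simpa using hx)) (hL y (by simpa using hy)) hxy
  -- membership is transported by injectivity
  have hmem : ∀ {A B : List Tri}, (∀ p ∈ A, wfT p = true) → (∀ p ∈ B, wfT p = true) →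
      Multiset.map tr3 (A : Multiset Tri) = Multiset.map tr3 (B : Multiset Tri) →
      ∀ t ∈ A, t ∈ B := by
    intro A B hA hB hAB t ht
    have : tr3 t ∈ Multiset.map tr3 (B : Multiset Tri) := by
      rw [← hAB]; exact Multiset.mem_map.mpr ⟨t, by simpa using ht, rfl⟩
    obtain ⟨t', ht', htt'⟩ := Multiset.mem_map.mp this
    have ht'B : t' ∈ B := by simpa using ht'
    rwa [← tr3_injOn (hB t' ht'B) (hA t ht) htt']
  ext t
  by_cases ht₁ : t ∈ L₁
  · have ht₂ : t ∈ L₂ := hmem h₁ h₂ h t ht₁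
    have c₁ := Multiset.count_map_eq_count tr3 (L₁ : Multiset Tri) (hinj L₁ h₁) t (by simpa using ht₁)
    have c₂ := Multiset.count_map_eq_count tr3 (L₂ : Multiset Tri) (hinj L₂ h₂) t (by simpa using ht₂)
    rw [← c₁, ← c₂, h]
  · have ht₂ : t ∉ L₂ := fun ht₂ => ht₁ (hmem h₂ h₁ h.symm t ht₂)
    rw [Multiset.count_eq_zero_of_notMem (by simpa using ht₁),
      Multiset.count_eq_zero_of_notMem (by simpa using ht₂)]

/-- Two schemes with the same elements are equal (bookkeeping). [folklore] -/
private theorem scheme_ext {t₀ : T} {x y : Scheme t₀} (h : x.elts = y.elts) : x = y := by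
  cases x; cases y; cases h; rfl

/-- **Soundness of the orbit test:** schemes presented by well-formed code lists `L`, `L'` with
`noMatch L L'` are NOT equivalent under KM's symmetry group `G`.
[cite: KauersMoosbauer2022FlipGraphs, §2 ("call two schemes equivalent if they belong to the same orbit")] -/
theorem not_equiv_of_noMatch {x y : Scheme (matMulTensor (ZMod 2) 2 2 2)} {L L' : List Tri}
    (hx : x.elts = elts3 L) (hy : y.elts = elts3 L') (hL : wfL L = true) (hL' : wfL L' = true)
    (h : noMatch L L' = true) : ¬ (orbitSetoidKM (ZMod 2) 2).r x y := by
  rintro ⟨φ, hφ, rfl⟩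
  obtain ⟨g, hg, hact⟩ := InSymmetryGroup.exists_word hφ
  have hmap : (elts3 L).map φ.toLinearEquiv = elts3 (L.map (actNF g)) := by
    simp only [elts3, Multiset.map_coe, List.map_map]
    exact congrArg _ (List.map_congr_left fun t ht => hact t (wfL_iff'.mp hL t ht))
  have hy' : elts3 (L.map (actNF g)) = elts3 L' := by
    rw [← hmap, ← hx, ← hy, Scheme.map_elts]
  have hwf : wfL (L.map (actNF g)) = true :=
    wfL_iff'.mpr fun p hp => by
      obtain ⟨t, ht, rfl⟩ := List.mem_map.mp hp
      exact wfT_actNF hg (wfL_iff'.mp hL t ht)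
  have hms := coe_eq_of_elts3_eq hwf hL' hy'
  have hall := List.all_eq_true.mp h g (mem_words hg)
  simp [hms] at hall

/-! ## §3 The seven schemes (code lists `(z, x, y)`: output pattern, `A`-form, `B`-form) -/

/-- A scheme of Strassen's ORBIT, as codes: the endpoint `V8` of the walk of
`FlipGraphStandardToStrassen.lean` (`V8 = g · strassen`). [cite: KauersMoosbauer2022FlipGraphs, §4 ("The component also contains Strassen's algorithm")] -/
def LS : List Tri := [(1, 3, 12), (3, 10, 8), (4, 12, 1), (8, 5, 2), (10, 1, 15), (11, 9, 13), (15, 8, 5)]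

/-- `LS` presents `V8`. [cite: KauersMoosbauer2022FlipGraphs, §4] -/
theorem V8_elts : StdToStrassenZ2.V8.elts = elts3 LS := by
  show StdToStrassenZ2.elts StdToStrassenZ2.L8 = elts3 LS
  decide +kernel

/-- Hidden scheme `0`: `LS` with its element `(1,3,12)` split in the third factor as `12 = 7 + 11`;
it admits no flip (cell orbit id `268`). [cite: KauersMoosbauer2022FlipGraphs, §3 (splits) and §4] -/
def H0 : List Tri := [(1, 3, 7), (1, 3, 11), (3, 10, 8), (4, 12, 1), (8, 5, 2), (10, 1, 15), (11, 9, 13), (15, 8, 5)]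
/-- Hidden scheme `1`: split `12 = 6 + 10` of the same element; no flip (cell orbit id `269`).
[cite: KauersMoosbauer2022FlipGraphs, §3 (splits) and §4] -/
def H1 : List Tri := [(1, 3, 6), (1, 3, 10), (3, 10, 8), (4, 12, 1), (8, 5, 2), (10, 1, 15), (11, 9, 13), (15, 8, 5)]
/-- Hidden scheme `2`: `LS` with its element `(11,9,13)` split as `13 = 3 + 14`; no flip (cell orbit
id `270`). [cite: KauersMoosbauer2022FlipGraphs, §3 (splits) and §4] -/
def H2 : List Tri := [(11, 9, 3), (11, 9, 14), (1, 3, 12), (3, 10, 8), (4, 12, 1), (8, 5, 2), (10, 1, 15), (15, 8, 5)]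
/-- Hidden scheme `3`: split `13 = 6 + 11` of the same element; no flip (cell orbit id `271` — the
orbit absent from the authors' published vertex data). [cite: KauersMoosbauer2022FlipGraphs, §3 (splits) and §4] -/
def H3 : List Tri := [(11, 9, 6), (11, 9, 11), (1, 3, 12), (3, 10, 8), (4, 12, 1), (8, 5, 2), (10, 1, 15), (15, 8, 5)]
/-- Hidden scheme `4`: split `12 = 2 + 14` of `(1,3,12)`; reducible, with flips to the orbits of `H5`
and `H6` only (cell orbit id `251`). [cite: KauersMoosbauer2022FlipGraphs, §3 (splits) and §4] -/
def H4 : List Tri := [(1, 3, 2), (1, 3, 14), (3, 10, 8), (4, 12, 1), (8, 5, 2), (10, 1, 15), (11, 9, 13), (15, 8, 5)]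
/-- Hidden scheme `5`: a flip of `H4` (shared `B`-form `2`; cell orbit id `258`).
[cite: KauersMoosbauer2022FlipGraphs, Def. 4 and §4] -/
def H5 : List Tri := [(1, 6, 2), (9, 5, 2), (1, 3, 14), (3, 10, 8), (4, 12, 1), (10, 1, 15), (11, 9, 13), (15, 8, 5)]
/-- Hidden scheme `6`: the other flip of `H4` on the same pair (cell orbit id `266`).
[cite: KauersMoosbauer2022FlipGraphs, Def. 4 and §4] -/
def H6 : List Tri := [(9, 3, 2), (8, 6, 2), (1, 3, 14), (3, 10, 8), (4, 12, 1), (10, 1, 15), (11, 9, 13), (15, 8, 5)]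

/-- The table of the seven hidden schemes. [cite: KauersMoosbauer2022FlipGraphs, §4] -/
def hidden : List (List Tri) := [H0, H1, H2, H3, H4, H5, H6]

/-- The standard algorithm of `⟨2,2,2⟩` as codes (`e_{κν} ⊗ e_{κμ} ⊗ e_{μν}`).
[cite: KauersMoosbauer2022FlipGraphs, §4 ("the standard algorithm")] -/
def stdL : List Tri := [(1, 1, 1), (1, 2, 4), (4, 4, 1), (4, 8, 4), (2, 1, 2), (2, 2, 8), (8, 4, 2), (8, 8, 8)]

/-- `stdL` presents the standard algorithm. [cite: KauersMoosbauer2022FlipGraphs, §4] -/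
theorem stdScheme_elts' : (stdScheme (matMulTensor (ZMod 2) 2 2 2)).elts = elts3 stdL := by
  rw [stdScheme_elts]
  decide +kernel

/-- The seven code lists are well formed, of length `8` (kernel evaluation). [folklore] -/
private theorem hidden_wf_len : ∀ i : Fin 7, wfL (hidden.getD i.val []) = true ∧ (hidden.getD i.val []).length = 8 := by
  decide

/-- The seven code lists present schemes of `⟨2,2,2⟩` over `ℤ₂`: their tensors sum to the matrix
multiplication tensor (kernel evaluation of KM's Brent equations, §5).
[cite: KauersMoosbauer2022FlipGraphs, Def. 1 and §5] -/
theorem hidden_sum : ∀ i : Fin 7, (elts3 (hidden.getD i.val [])).sum = matMulTensor (ZMod 2) 2 2 2 := by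
  decide +kernel

/-- Membership in a presented multiset (bookkeeping). [folklore] -/
private theorem exists_of_mem_elts3 {L : List Tri} {τ : T} (h : τ ∈ elts3 L) : ∃ p ∈ L, tr3 p = τ := by
  simpa [elts3] using h

/-- A well-formed code list whose tensors sum to `⟨2,2,2⟩` is a scheme (KM Def. 1: non-zero rank-one
tensors summing to `M_{2,2,2}`). [cite: KauersMoosbauer2022FlipGraphs, Def. 1] -/
def schemeOf (L : List Tri) (hw : wfL L = true)
    (hs : (elts3 L).sum = matMulTensor (ZMod 2) 2 2 2) : Scheme (matMulTensor (ZMod 2) 2 2 2) where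
  elts := elts3 L
  ne_zero τ hτ := by
    obtain ⟨p, hp, rfl⟩ := exists_of_mem_elts3 hτ
    exact tr3_ne_zero (wfL_iff'.mp hw p hp)
  exists_triad τ hτ := by
    obtain ⟨p, hp, rfl⟩ := exists_of_mem_elts3 hτ
    exact ⟨_, _, _, rfl⟩
  sum_eq := hs

/-- **The seven hidden schemes** `hs i`, `i < 7`. [cite: KauersMoosbauer2022FlipGraphs, Def. 1 and §4] -/
def hs (i : Fin 7) : Scheme (matMulTensor (ZMod 2) 2 2 2) :=
  schemeOf (hidden.getD i.val []) (hidden_wf_len i).1 (hidden_sum i)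

/-- Their elements. [cite: KauersMoosbauer2022FlipGraphs, Def. 1] -/
theorem hs_elts (i : Fin 7) : (hs i).elts = elts3 (hidden.getD i.val []) := rfl

/-- They have rank `8`. [cite: KauersMoosbauer2022FlipGraphs, Def. 1 ("We call `|S|` the rank of the scheme")] -/
theorem rank_hs (i : Fin 7) : (hs i).rank = 8 := by
  rw [Scheme.rank, hs_elts, elts3, Multiset.coe_card, List.length_map]
  exact (hidden_wf_len i).2

/-- A scheme presented up to `G` by a hidden code list has rank `8`. [cite: KauersMoosbauer2022FlipGraphs, §2 and Def. 8] -/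
theorem rank_eq_eight_of_elts {x : Scheme (matMulTensor (ZMod 2) 2 2 2)}
    {φ : Symmetry (matMulTensor (ZMod 2) 2 2 2)} {i : Fin 7}
    (hx : x.elts = (elts3 (hidden.getD i.val [])).map φ.toLinearEquiv) : x.rank = 8 := by
  rw [Scheme.rank, hx, Multiset.card_map, elts3, Multiset.coe_card, List.length_map]
  exact (hidden_wf_len i).2

/-- **The hidden orbits as vertices** of KM's `(2,2,2)`-flip graph of rank at most `8` over `ℤ₂`.
[cite: KauersMoosbauer2022FlipGraphs, Def. 8 (2)] -/
noncomputable def hv (i : Fin 7) : Vtx222LE8 :=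
  ⟨Quotient.mk _ (hs i), by rw [orbitRankKM_mk, rank_hs]⟩

/-! ## §4 The edges: five reductions into Strassen's orbit, two flips -/

/-- `H0` reduces to `LS` (merge the split pair: KM §3 "admits a reduction to `S`").
[cite: KauersMoosbauer2022FlipGraphs, §3 (splits) and Prop. 3] -/
theorem reduces_H0 : Reduces (elts3 H0) (elts3 LS) := by
  have h₁ : elts3 H0 = triad (dec 1) (dec 3) (dec 12 - dec 11) ::ₘ triad (dec 1) (dec 3) (dec 11) ::ₘ
      elts3 [(3, 10, 8), (4, 12, 1), (8, 5, 2), (10, 1, 15), (11, 9, 13), (15, 8, 5)] := by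
    decide +kernel
  have h₂ : elts3 LS = triad (dec 1) (dec 3) (dec 12) ::ₘ
      elts3 [(3, 10, 8), (4, 12, 1), (8, 5, 2), (10, 1, 15), (11, 9, 13), (15, 8, 5)] := by
    decide +kernel
  rw [h₁, h₂]
  exact reduces_of_split₃ _ _ _ _ _

/-- `H1` reduces to `LS`. [cite: KauersMoosbauer2022FlipGraphs, §3 (splits) and Prop. 3] -/
theorem reduces_H1 : Reduces (elts3 H1) (elts3 LS) := by
  have h₁ : elts3 H1 = triad (dec 1) (dec 3) (dec 12 - dec 10) ::ₘ triad (dec 1) (dec 3) (dec 10) ::ₘ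
      elts3 [(3, 10, 8), (4, 12, 1), (8, 5, 2), (10, 1, 15), (11, 9, 13), (15, 8, 5)] := by
    decide +kernel
  have h₂ : elts3 LS = triad (dec 1) (dec 3) (dec 12) ::ₘ
      elts3 [(3, 10, 8), (4, 12, 1), (8, 5, 2), (10, 1, 15), (11, 9, 13), (15, 8, 5)] := by
    decide +kernel
  rw [h₁, h₂]
  exact reduces_of_split₃ _ _ _ _ _

/-- `H2` reduces to `LS`. [cite: KauersMoosbauer2022FlipGraphs, §3 (splits) and Prop. 3] -/
theorem reduces_H2 : Reduces (elts3 H2) (elts3 LS) := by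
  have h₁ : elts3 H2 = triad (dec 11) (dec 9) (dec 13 - dec 14) ::ₘ triad (dec 11) (dec 9) (dec 14) ::ₘ
      elts3 [(1, 3, 12), (3, 10, 8), (4, 12, 1), (8, 5, 2), (10, 1, 15), (15, 8, 5)] := by
    decide +kernel
  have h₂ : elts3 LS = triad (dec 11) (dec 9) (dec 13) ::ₘ
      elts3 [(1, 3, 12), (3, 10, 8), (4, 12, 1), (8, 5, 2), (10, 1, 15), (15, 8, 5)] := by
    decide +kernel
  rw [h₁, h₂]
  exact reduces_of_split₃ _ _ _ _ _

/-- `H3` reduces to `LS`. [cite: KauersMoosbauer2022FlipGraphs, §3 (splits) and Prop. 3] -/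
theorem reduces_H3 : Reduces (elts3 H3) (elts3 LS) := by
  have h₁ : elts3 H3 = triad (dec 11) (dec 9) (dec 13 - dec 11) ::ₘ triad (dec 11) (dec 9) (dec 11) ::ₘ
      elts3 [(1, 3, 12), (3, 10, 8), (4, 12, 1), (8, 5, 2), (10, 1, 15), (15, 8, 5)] := by
    decide +kernel
  have h₂ : elts3 LS = triad (dec 11) (dec 9) (dec 13) ::ₘ
      elts3 [(1, 3, 12), (3, 10, 8), (4, 12, 1), (8, 5, 2), (10, 1, 15), (15, 8, 5)] := by
    decide +kernel
  rw [h₁, h₂]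
  exact reduces_of_split₃ _ _ _ _ _

/-- `H4` reduces to `LS`. [cite: KauersMoosbauer2022FlipGraphs, §3 (splits) and Prop. 3] -/
theorem reduces_H4 : Reduces (elts3 H4) (elts3 LS) := by
  have h₁ : elts3 H4 = triad (dec 1) (dec 3) (dec 12 - dec 14) ::ₘ triad (dec 1) (dec 3) (dec 14) ::ₘ
      elts3 [(3, 10, 8), (4, 12, 1), (8, 5, 2), (10, 1, 15), (11, 9, 13), (15, 8, 5)] := by
    decide +kernel
  have h₂ : elts3 LS = triad (dec 1) (dec 3) (dec 12) ::ₘ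
      elts3 [(3, 10, 8), (4, 12, 1), (8, 5, 2), (10, 1, 15), (11, 9, 13), (15, 8, 5)] := by
    decide +kernel
  rw [h₁, h₂]
  exact reduces_of_split₃ _ _ _ _ _

/-- **The five reducible hidden schemes reduce to a scheme of Strassen's orbit** (`V8`).
[cite: KauersMoosbauer2022FlipGraphs, §3 (splits), Prop. 3 and §4] -/
theorem reduces_hs_V8 (i : Fin 7) (hi : i.val ≤ 4) : Reduces (hs i).elts StdToStrassenZ2.V8.elts := by
  rw [hs_elts, V8_elts]
  obtain ⟨i, hi7⟩ := i
  simp only at hi ⊢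
  interval_cases i
  · exact reduces_H0
  · exact reduces_H1
  · exact reduces_H2
  · exact reduces_H3
  · exact reduces_H4

/-- `H5` is a flip of `H4` (KM Def. 4 with the shared factor the `B`-form `2`, `T = A⊗B'⊗Γ` in the
slot-permuted reading). [cite: KauersMoosbauer2022FlipGraphs, Def. 4] -/
theorem flips_H4_H5 : Flips (elts3 H4) (elts3 H5) := by
  refine Or.inr (Or.inr ⟨dec 2, dec 3, dec 5, dec 1, dec 8,
    (↑[triad (dec 14) (dec 3) (dec 1), triad (dec 8) (dec 10) (dec 3), triad (dec 1) (dec 12) (dec 4),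
       triad (dec 15) (dec 1) (dec 10), triad (dec 13) (dec 9) (dec 11), triad (dec 5) (dec 8) (dec 15)] :
      Multiset T), by decide +kernel, Or.inr (by decide +kernel)⟩)

/-- `H6` is a flip of `H4` (the other choice `T = A⊗B⊗Γ'` on the same pair).
[cite: KauersMoosbauer2022FlipGraphs, Def. 4] -/
theorem flips_H4_H6 : Flips (elts3 H4) (elts3 H6) := by
  refine Or.inr (Or.inr ⟨dec 2, dec 3, dec 5, dec 1, dec 8,
    (↑[triad (dec 14) (dec 3) (dec 1), triad (dec 8) (dec 10) (dec 3), triad (dec 1) (dec 12) (dec 4),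
       triad (dec 15) (dec 1) (dec 10), triad (dec 13) (dec 9) (dec 11), triad (dec 5) (dec 8) (dec 15)] :
      Multiset T), by decide +kernel, Or.inl (by decide +kernel)⟩)

/-! ## §5 The certificates (kernel evaluation) -/

/-- `hs 0, …, hs 3` ADMIT NO FLIP: every candidate of the complete flip enumerator `flipsAll` has a
zero factor (the only pairs sharing a factor are the two split pieces, which share two factors).
[cite: KauersMoosbauer2022FlipGraphs, Def. 4] -/
theorem isolated_cert : ∀ i : Fin 4, ((flipsAll (hidden.getD i.val [])).all hasZeroB) = true := by
  decide

/-- The flip→orbit witnesses for the closure of the seven orbits under flips: for each entry of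
`flipsAll (hidden[i])`, a target index and a word of `G` mapping the flip result onto the target
representative (degenerate entries carry a dummy). [cite: KauersMoosbauer2022FlipGraphs, Def. 4 and §2] -/
def hwits : List (List W) :=
  [[(0, 0, 0, 0, 0), (0, 0, 0, 0, 0), (0, 0, 0, 0, 0), (0, 0, 0, 0, 0), (0, 0, 0, 0, 0), (0, 0, 0, 0, 0), (0, 0, 0, 0, 0), (0, 0, 0, 0, 0)],
   [(0, 0, 0, 0, 0), (0, 0, 0, 0, 0), (0, 0, 0, 0, 0), (0, 0, 0, 0, 0), (0, 0, 0, 0, 0), (0, 0, 0, 0, 0), (0, 0, 0, 0, 0), (0, 0, 0, 0, 0)],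
   [(0, 0, 0, 0, 0), (0, 0, 0, 0, 0), (0, 0, 0, 0, 0), (0, 0, 0, 0, 0), (0, 0, 0, 0, 0), (0, 0, 0, 0, 0), (0, 0, 0, 0, 0), (0, 0, 0, 0, 0)],
   [(0, 0, 0, 0, 0), (0, 0, 0, 0, 0), (0, 0, 0, 0, 0), (0, 0, 0, 0, 0), (0, 0, 0, 0, 0), (0, 0, 0, 0, 0), (0, 0, 0, 0, 0), (0, 0, 0, 0, 0)],
   [(0, 0, 0, 0, 0), (0, 0, 0, 0, 0), (0, 0, 0, 0, 0), (0, 0, 0, 0, 0), (0, 0, 0, 0, 0), (0, 0, 0, 0, 0), (0, 0, 0, 0, 0), (0, 0, 0, 0, 0), (6, 0, 2, 2, 2), (5, 0, 2, 2, 2), (5, 0, 2, 2, 2), (6, 0, 2, 2, 2)],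
   [(6, 4, 3, 1, 0), (4, 5, 2, 2, 5), (4, 5, 2, 2, 5), (6, 4, 3, 1, 0), (6, 0, 2, 2, 2), (4, 0, 2, 2, 2), (4, 0, 2, 2, 2), (6, 0, 2, 2, 2)],
   [(5, 1, 0, 1, 0), (4, 1, 0, 1, 0), (4, 1, 0, 1, 0), (5, 1, 0, 1, 0), (4, 0, 2, 2, 2), (5, 0, 2, 2, 2), (5, 0, 2, 2, 2), (4, 0, 2, 2, 2)]]

/-- **Closure certificate:** every flip of every hidden representative is degenerate or equivalent to
a hidden representative (the checker `allMatchB` of `FlipGraph222BallCert.lean`).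
[cite: KauersMoosbauer2022FlipGraphs, Def. 4, §2–§3] -/
theorem hidden_ok : ((List.range 7).all fun i =>
    allMatchB hidden 7 (flipsAll (hidden.getD i [])) (hwits.getD i [])) = true := by
  decide +kernel

/-- **Orbit certificate, standard algorithm:** no word of `G` maps the standard algorithm onto a
hidden representative. [cite: KauersMoosbauer2022FlipGraphs, §2 and §4] -/
theorem noMatch_std : ∀ i : Fin 7, noMatch stdL (hidden.getD i.val []) = true := by
  decide +kernel

/-- **Orbit certificate, pairwise:** no word of `G` maps one hidden representative onto another.
[cite: KauersMoosbauer2022FlipGraphs, §2 and §4] -/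
theorem noMatch_pairs : ∀ i j : Fin 7, i < j → noMatch (hidden.getD i.val []) (hidden.getD j.val []) = true := by
  decide +kernel

/-! ## §6 Soundness: the seven orbits are in the component, forward-unreachable, distinct -/

/-- Soundness of `allMatchB`: every listed result has a matching witness (as in
`FlipGraph222BallCert.lean`). [folklore] -/
private theorem allMatchB_sound' {reps : List (List Tri)} {bound : ℕ} :
    ∀ (rs : List (List Tri)) (ws : List W), allMatchB reps bound rs ws = true →
      ∀ r ∈ rs, ∃ w, matchB reps bound r w = true
  | [], _, _ => by simp
  | _ :: _, [], h => by simp [allMatchB] at h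
  | r :: rs, w :: ws, h => by
    simp only [allMatchB, Bool.and_eq_true] at h
    intro r' hr'
    rcases List.mem_cons.mp hr' with rfl | hr'
    · exact ⟨w, h.1⟩
    · exact allMatchB_sound' rs ws h.2 r' hr'

/-- The certificate entry of index `i`. [folklore] -/
private theorem hidden_ok_at (i : Fin 7) :
    allMatchB hidden 7 (flipsAll (hidden.getD i.val [])) (hwits.getD i.val []) = true := by
  have h := hidden_ok
  rw [List.all_eq_true] at h
  exact h i.val (List.mem_range.mpr i.isLt)

/-- **The hidden orbits are closed under flips:** a flip of a scheme equivalent to a hidden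
representative is equivalent to a hidden representative. [cite: KauersMoosbauer2022FlipGraphs, Def. 4 and §3 ("if `S'` is a flip of `S` and `g ∈ G` then `g(S')` is a flip of `g(S)`")] -/
theorem hidden_flip_closed {i : Fin 7} {x y : Scheme (matMulTensor (ZMod 2) 2 2 2)}
    {φ : Symmetry (matMulTensor (ZMod 2) 2 2 2)} (hφ : InSymmetryGroup φ)
    (hx : x.elts = (elts3 (hidden.getD i.val [])).map φ.toLinearEquiv) (hflip : Flips x.elts y.elts) :
    ∃ j : Fin 7, ∃ ψ : Symmetry (matMulTensor (ZMod 2) 2 2 2), InSymmetryGroup ψ ∧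
      y.elts = (elts3 (hidden.getD j.val [])).map ψ.toLinearEquiv := by
  have hwf := (hidden_wf_len i).1
  -- pull the flip back to the representative
  have h' := hφ.symm.map_flips (x := x) (y := y) hflip
  rw [show (x.map φ.symm).elts = elts3 (hidden.getD i.val []) from map_symm_elts_eq hx] at h'
  obtain ⟨r, hr, hyr⟩ := exists_mem_flipsAll_of_flips hwf h'
  obtain ⟨w, hw⟩ := allMatchB_sound' _ _ (hidden_ok_at i) r hr
  obtain ⟨hlt, hg, hbd, hmatch⟩ := matchB_sound hw (hasZeroB_eq_false (y.map φ.symm) hyr)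
  refine ⟨⟨w.1, hlt⟩, (φ.symm.trans (symOf w.2)).symm, (hφ.symm.trans (inSymmetryGroup_symOf _)).symm, ?_⟩
  have hz : ((y.map φ.symm).map (symOf w.2)).elts = elts3 (hidden.getD w.1 []) := by
    rw [Scheme.map_elts, hyr, map_symOf_elts3 _ hg r hbd, hmatch]
  have hy : y = (y.map (φ.symm.trans (symOf w.2))).map (φ.symm.trans (symOf w.2)).symm :=
    (Scheme.map_map_symm _ y).symm
  rw [hy, Scheme.map_elts, Scheme.map_trans, hz]

/-- **The hidden predicate** on orbits: the orbit of a scheme presented, up to `G`, by one of the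
seven hidden code lists. [cite: KauersMoosbauer2022FlipGraphs, §2 (equivalence) and §4] -/
def IsHidden (p : Quotient (orbitSetoidKM (ZMod 2) 2)) : Prop :=
  ∃ (x : Scheme (matMulTensor (ZMod 2) 2 2 2)) (φ : Symmetry (matMulTensor (ZMod 2) 2 2 2)) (i : Fin 7),
    InSymmetryGroup φ ∧ p = Quotient.mk _ x ∧ x.elts = (elts3 (hidden.getD i.val [])).map φ.toLinearEquiv

/-- The orbits of the seven schemes are hidden. [cite: KauersMoosbauer2022FlipGraphs, §4] -/
theorem isHidden_hv (i : Fin 7) : IsHidden (hv i).1 :=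
  ⟨hs i, Symmetry.refl _, i, InSymmetryGroup.refl, rfl, by rw [hs_elts]; simp [Symmetry.refl]⟩

/-- Hidden orbits have rank `8`. [cite: KauersMoosbauer2022FlipGraphs, Def. 8] -/
theorem orbitRankKM_of_isHidden {p : Quotient (orbitSetoidKM (ZMod 2) 2)} (hp : IsHidden p) :
    orbitRankKM p = 8 := by
  obtain ⟨x, φ, i, -, rfl, hx⟩ := hp
  rw [orbitRankKM_mk]
  exact rank_eq_eight_of_elts hx

/-- **No edge enters the hidden set from outside (at rank `≤ 8`):** if `p → p'` is an edge of KM's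
flip graph (a flip or a reduction of a representative), `p'` is hidden and `p` has rank `≤ 8`, then
`p` is hidden — a flip is reversible and the hidden orbits are closed under flips; a reduction into a
rank-`8` orbit starts at rank `≥ 9`. [cite: KauersMoosbauer2022FlipGraphs, Def. 8, §3 ("flips are reversible")] -/
theorem isHidden_of_edge {p p' : Quotient (orbitSetoidKM (ZMod 2) 2)}
    (he : flipGraphKM (ZMod 2) 2 p p') (hp' : IsHidden p') (hr : orbitRankKM p ≤ 8) : IsHidden p := by
  obtain ⟨y, φ, i, hφ, rfl, hy⟩ := hp'
  induction p using Quotient.ind with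
  | _ x =>
    rw [orbitRankKM_mk] at hr
    obtain ⟨y', ⟨χ, hχ, hy'⟩, hadj⟩ := (flipGraphKM_mk_iff x y).mp he
    have hy'e : y'.elts = (elts3 (hidden.getD i.val [])).map (φ.trans χ).toLinearEquiv := by
      rw [hy', Scheme.map_elts, hy, Multiset.map_map]; rfl
    rcases hadj with hflip | hred
    · obtain ⟨j, ψ, hψ, hxe⟩ := hidden_flip_closed (hφ.trans hχ) hy'e hflip.symm
      exact ⟨x, ψ, j, hψ, rfl, hxe⟩
    · have hlt : y'.rank < x.rank := hred.card_lt
      have h8 : y'.rank = 8 := rank_eq_eight_of_elts hy'e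
      omega

/-- Ranks do not increase along directed paths from the standard algorithm (all `≤ 8`).
[cite: KauersMoosbauer2022FlipGraphs, Def. 8 (remark following it)] -/
theorem orbitRankKM_le_of_fwd {p : Quotient (orbitSetoidKM (ZMod 2) 2)}
    (h : Relation.ReflTransGen (flipGraphKM (ZMod 2) 2)
      (Quotient.mk _ (stdScheme (matMulTensor (ZMod 2) 2 2 2))) p) : orbitRankKM p ≤ 8 := by
  induction h with
  | refl => rw [orbitRankKM_mk, rank_stdScheme_matMulTensor]
  | tail _ hbc ih => exact (orbitRankKM_le_of_flipGraphKM hbc).trans ih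

/-- **The orbit of the standard algorithm is not hidden** (orbit certificate `noMatch_std`).
[cite: KauersMoosbauer2022FlipGraphs, §2 and §4] -/
theorem not_isHidden_std : ¬ IsHidden (Quotient.mk _ (stdScheme (matMulTensor (ZMod 2) 2 2 2))) := by
  rintro ⟨x, φ, i, hφ, hq, hx⟩
  -- `x = φ · hs i`, so `std ~ hs i`
  have hxe : x = (hs i).map φ := scheme_ext (by rw [Scheme.map_elts, hs_elts, hx])
  have h1 : (orbitSetoidKM (ZMod 2) 2).r (stdScheme _) x := Quotient.exact hq
  have h2 : (orbitSetoidKM (ZMod 2) 2).r (stdScheme _) (hs i) :=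
    (orbitSetoidKM (ZMod 2) 2).iseqv.trans h1
      ((orbitSetoidKM (ZMod 2) 2).iseqv.symm ⟨φ, hφ, hxe⟩)
  exact not_equiv_of_noMatch stdScheme_elts' (hs_elts i) (by decide) (hidden_wf_len i).1
    (noMatch_std i) h2

/-- **(b) Forward unreachability:** no hidden orbit — in particular none of the seven `hv i` — is
reachable from the orbit of the standard algorithm by a DIRECTED path of KM's flip graph (flips and
reductions applied from the standard algorithm onward). [cite: KauersMoosbauer2022FlipGraphs, Def. 8 and §4 (Fig. 1)] -/
theorem not_fwdReachable_of_isHidden {p : Quotient (orbitSetoidKM (ZMod 2) 2)} (hp : IsHidden p) :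
    ¬ Relation.ReflTransGen (flipGraphKM (ZMod 2) 2)
        (Quotient.mk _ (stdScheme (matMulTensor (ZMod 2) 2 2 2))) p := by
  intro h
  -- walking the path backwards keeps hiddenness, down to the standard algorithm
  suffices key : ∀ q, Relation.ReflTransGen (flipGraphKM (ZMod 2) 2)
      (Quotient.mk _ (stdScheme (matMulTensor (ZMod 2) 2 2 2))) q → IsHidden q →
      IsHidden (Quotient.mk _ (stdScheme (matMulTensor (ZMod 2) 2 2 2))) from
    not_isHidden_std (key p h hp)
  intro q hq
  induction hq with
  | refl => exact id
  | tail hab hbc ih => exact fun hc => ih (isHidden_of_edge hbc hc (orbitRankKM_le_of_fwd hab))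

/-- **(b) for the seven vertices.** [cite: KauersMoosbauer2022FlipGraphs, Def. 8 and §4 (Fig. 1)] -/
theorem not_fwdReachable_hv (i : Fin 7) :
    ¬ Relation.ReflTransGen (flipGraphKM (ZMod 2) 2) vtxStd.1 (hv i).1 :=
  not_fwdReachable_of_isHidden (isHidden_hv i)

/-- `hs 0, …, hs 3` admit no flip to any scheme (KM: such a vertex "has no neighbors" by flips).
[cite: KauersMoosbauer2022FlipGraphs, Def. 4 and §4] -/
theorem not_flips_hs (i : Fin 7) (hi : i.val < 4) (y : Scheme (matMulTensor (ZMod 2) 2 2 2)) :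
    ¬ Flips (hs i).elts y.elts := by
  intro hf
  rw [hs_elts] at hf
  obtain ⟨r, hr, hyr⟩ := exists_mem_flipsAll_of_flips (hidden_wf_len i).1 hf
  have hz : hasZeroB r = true := by
    have h := isolated_cert ⟨i.val, hi⟩
    rw [List.all_eq_true] at h
    exact h r hr
  exact absurd (hasZeroB_eq_false y hyr) (by rw [hz]; decide)

/-- The orbit of `V8` is Strassen's vertex. [cite: KauersMoosbauer2022FlipGraphs, §4] -/
private theorem mk_V8 : (Quotient.mk (orbitSetoidKM (ZMod 2) 2) StdToStrassenZ2.V8) = vtxStrassen.1 :=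
  (Quotient.sound StdToStrassenZ2.equiv_strassen).symm

/-- **(a), reductions:** for `i ≤ 4` the vertex `hv i` is adjacent to Strassen's vertex in the
undirected graph underlying KM's flip graph of rank at most `8` (a reduction arrow INTO Strassen's
orbit). [cite: KauersMoosbauer2022FlipGraphs, Def. 8 and §4 (Fig. 1: "reductions by directed edges")] -/
theorem adj_hv_vtxStrassen (i : Fin 7) (hi : i.val ≤ 4) : flipGraph222LE8.Adj (hv i) vtxStrassen := by
  refine (SimpleGraph.fromRel_adj _ _ _).mpr ⟨fun h => ?_, Or.inl ?_⟩
  · have := congrArg (fun v : Vtx222LE8 => orbitRankKM v.1) h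
    simp only [hv, vtxStrassen, orbitRankKM_mk, rank_hs, StdToStrassenZ2.rank_strassen] at this
    omega
  · show flipGraphKM (ZMod 2) 2 (Quotient.mk _ (hs i)) vtxStrassen.1
    rw [← mk_V8]
    exact ⟨_, _, rfl, rfl, Or.inr (reduces_hs_V8 i hi)⟩

/-- Distinctness of the seven vertices from the orbit certificate. [cite: KauersMoosbauer2022FlipGraphs, §2 and §4] -/
theorem hv_injective : Function.Injective hv := by
  intro i j hij
  have hr : (orbitSetoidKM (ZMod 2) 2).r (hs i) (hs j) := Quotient.exact (congrArg Subtype.val hij)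
  by_contra hne
  rcases lt_or_gt_of_ne hne with hlt | hlt
  · exact not_equiv_of_noMatch (hs_elts i) (hs_elts j) (hidden_wf_len i).1 (hidden_wf_len j).1
      (noMatch_pairs i j hlt) hr
  · exact not_equiv_of_noMatch (hs_elts j) (hs_elts i) (hidden_wf_len j).1 (hidden_wf_len i).1
      (noMatch_pairs j i hlt) ((orbitSetoidKM (ZMod 2) 2).iseqv.symm hr)

/-- **(a), flips:** `hv 5` and `hv 6` are adjacent to `hv 4` (flips).
[cite: KauersMoosbauer2022FlipGraphs, Def. 4, Def. 8 and §4] -/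
theorem adj_hv4 (j : Fin 7) (hj : j.val = 5 ∨ j.val = 6) : flipGraph222LE8.Adj (hv 4) (hv j) := by
  refine (SimpleGraph.fromRel_adj _ _ _).mpr ⟨fun h => ?_, Or.inl ?_⟩
  · have e : (4 : ℕ) = j.val := by simpa using congrArg Fin.val (hv_injective h)
    omega
  · refine ⟨hs 4, hs j, rfl, rfl, Or.inl ?_⟩
    rw [hs_elts, hs_elts]
    obtain ⟨j, hj7⟩ := j
    rcases hj with h5 | h6
    · simp only at h5; subst h5; exact flips_H4_H5
    · simp only at h6; subst h6; exact flips_H4_H6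

/-- **(a) Membership in the component of the standard algorithm:** each hidden vertex is joined to
`vtxStd` in the undirected graph underlying KM's `(2,2,2)`-flip graph of rank at most `8` — through
Strassen's vertex (distance `8` from `vtxStd`, `FlipGraphStdStrassenDistance.lean`).
[cite: KauersMoosbauer2022FlipGraphs, Thm. 9 (weak connectivity) and §4 (Fig. 1)] -/
theorem reachable_vtxStd_hv (i : Fin 7) : flipGraph222LE8.Reachable vtxStd (hv i) := by
  obtain ⟨p, -⟩ := exists_walk_std_strassen
  have hS : flipGraph222LE8.Reachable vtxStd vtxStrassen := ⟨p⟩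
  have h4 : flipGraph222LE8.Reachable vtxStd (hv 4) :=
    hS.trans (adj_hv_vtxStrassen 4 (by decide)).reachable.symm
  by_cases hi : i.val ≤ 4
  · exact hS.trans (adj_hv_vtxStrassen i hi).reachable.symm
  · exact h4.trans (adj_hv4 i (by omega)).reachable

/-- **KM §4 / Fig. 1, the component of the standard algorithm, `(2,2,2)` over `ℤ₂`: seven pairwise
distinct vertices of the component of the standard algorithm in KM's flip graph of rank at most `8`
(weak sense, Def. 8/Thm. 9) are NOT reachable from the standard algorithm by flips and reductions
(directed paths).** Four of them admit no flip at all and are attached to the component only by their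
reduction arrow into Strassen's orbit; the other three form a flip triangle hanging off such an
arrow. (Cell context, not part of the statement: an exhaustive enumeration finds `273` orbits in
this component against the printed `272`; the published vertex data contain six of these seven.)
[cite: KauersMoosbauer2022FlipGraphs, §4 ("It has 272 vertices … 1183 edges, 7 of which are reductions"), Def. 8, Thm. 9] -/
theorem kauersMoosbauer2023_fig1_component_has_seven_unreachable_vertices :
    ∃ v : Fin 7 → Vtx222LE8, Function.Injective v ∧
      ∀ i, flipGraph222LE8.Reachable vtxStd (v i) ∧
        ¬ Relation.ReflTransGen (flipGraphKM (ZMod 2) 2) vtxStd.1 (v i).1 ∧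
        orbitRankKM (v i).1 = 8 :=
  ⟨hv, hv_injective, fun i =>
    ⟨reachable_vtxStd_hv i, not_fwdReachable_hv i, by
      show orbitRankKM (Quotient.mk _ (hs i)) = 8
      rw [orbitRankKM_mk, rank_hs]⟩⟩

end Hidden222

end FlipGraph

end Literature.Computability.AlgebraicComplexity
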